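import Literature.NumberTheory.Automorphic.ParabolicIndGLSphericalUnramified
import Literature.NumberTheory.Automorphic.IrreducibleClassesComapSpherical
import Literature.NumberTheory.Automorphic.SmoothInductionAdmissibleOfCocompact
import Literature.NumberTheory.Automorphic.HeckeEigencharacterPackage
import Literature.NumberTheory.Automorphic.LocalUnitaryIntegralLevel
import Literature.NumberTheory.Automorphic.HeckeCharacterLocalComponentSmooth
import Literature.NumberTheory.GaloisRepresentations.HeckeCharacterCofiniteProofs
import Literature.NumberTheory.Rogawski1990.GlobalAPacketMembership
import HarnessLib

/-!
# The SPLIT-place instance of T5's anchor law `XiUnram` ∕ pins (ii)(iv): the unramified member `i_G(ξ_w)` of the split packet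
# `Π(ξ_v) = {i_G(ξ_w)}` is ADMISSIBLE and `K_v`-SPHERICAL WITH an eigencharacter (Rogawski §4.5, §12.2, §13.1; Cartier §IV.1)

Cell `hodgecm-mathlib`, F0∕P3 «U3-mult», crux H413 (`stmt-HodgeConjecture-24833`), rung 4, PLAN.F0P3g4 §24 Z7 (β) ∕ RULING (V19)(b) (F0P3-p01 (g7),
SPLIT half; the NON-SPLIT half is B-p08's `Theorems/F0P3XiUnramNonsplitInstance.lean`).  HELPER FILE, THEOREMS ONLY (no definition, no named
fact, no instance, no notation, no `sorry`), KIT-FREE: named theorems about the ★ D6 packet member `(cmSplitPacket …).πn = ⟦i_G(ξ_w) ∘ cmSplitEquiv⟧`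
(★ `Rogawski1990.CMLocalAPacketMembers`), consumed BY NAME by the T5 kit `𝔠₀` at ED. 4 (`packFin₀ ξ v := Pv v`, `tXi₀ ξ v :=` the normalised class
character of `(Pv v).πn`).

* §1 `GL₃` side: `isAdmissible_splitMemberGL` — `i_G(ξ_w) = i_{P_{(2,1)}}((ν₀ ∘ det) ⊠ χ′)` is ADMISSIBLE (★ `Representation.isAdmissible_smoothIndRep_of_isCompact`
  with `GL₃ = P · GL₃(𝒪)` ★ `exists_parabolic_mul_glInt` and ★ `isCompact_glInt`; no hypothesis on the labels).
* §2 the packet member on `G′_v = U(H)(L⁺_v)`: `isAdmissible_cmSplitPacket_πn` (unconditional); `isSpherical_cmSplitPacket_πn` for UNRAMIFIED labels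
  (`ν₀, χ′` trivial on the units of valuation `1`) at a place where `H_w ∈ GL₃(𝒪_w)` (★ `mem_localIntegralLevel_iff_of_ne`: `cmSplitEquiv` matches
  `K_v = U(H)(𝒪_v)` with `GL₃(𝒪_w)`; ★ `isSpherical_splitMemberGL`; ★ `IrrClass.isSpherical_comap_iff_of_forall_mem_iff`);
  `isSphericalWith_cmSplitPacket_πn` (the pin-(ii) currency ★ `IrrClass.IsSphericalWith K_v μ t` with `t` THE normalised class character, ★
  `IsSpherical.isSphericalWith_smoothTrace`, for any Haar `μ`) and the conjunction `xiUnram_cmSplitPacket` in the shape of RULING (V11)(ii).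
* §3 the same for a ξ-LOCAL FAMILY `Pv` (★ D6 `OneDimAutRepH.IsXiLocalFamily`, whose split clause IS `cmSplitPacket` at the fixed witness
  `w = splitWitness v hs` and the labels `ν₀ = η_w ψ_w μ_w`, `χ′ = ψ_w`): `isAdmissible_πn_of_isXiLocalFamily_of_split` (unconditional) and
  `isSpherical_πn_of_isXiLocalFamily_of_split` ∕ `isSphericalWith_πn_…` ∕ `xiUnram_of_isXiLocalFamily_of_split` under the HONEST unramified hypotheses
  `ξ.bcη.IsUnramifiedAt w`, `ξ.bcψ.IsUnramifiedAt w`, `μω.IsUnramifiedAt w` (★ `HeckeCharacter.IsUnramifiedAt`, bridged to the valuation currency by ★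
  `IsUnramifiedAt.localComponent_eq_one_of_valuation_eq_one`) and `H_w ∈ GL₃(𝒪_w)` — these hypotheses are what `v ∉ ram ξ` means at 𝔠₀ (split `v`).
* §4 `eventually_forall_placesOver_splitUnram` ∕ `eventually_xiUnram_of_isXiLocalFamily_of_split`: those hypotheses (hence `XiUnram`) hold at ALL BUT
  FINITELY MANY `v` (★ `HeckeCharacter.isUnramifiedAt_cofinite_holds` + ★ `eventually_forall_unit_placeForm_mem_glInt`) — the split part of `ram ξ` is finite.

References: [Rogawski1990] §4.5 p. 45 (unramified principal series, `dim V^K = 1` by Iwasawa), §12.2 pp. 173–174 (`πⁿ(ξ_v)` unramified iff `ξ_v` is),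
§13.1 p. 199 (split `v`: `Π(ξ_v) = {i_G(ξ_v)}`), §4.13 Lemma 4.13.1 (b), §13.7 p. 206; [CartierCorvallis1979] §III.3, §IV.1 Thm. 4.1 ∕ Cor. 4.1;
[BernsteinZelevinsky1976] §2.25; [BushnellHenniart2006] §1.1–1.2; [PlatonovRapinchuk1994] §5.1.
HC_CM is proved only modulo the printed citations until rung 0 closes.
-/

set_option autoImplicit false
set_option linter.dupNamespace false

noncomputable section

open NumberField IsDedekindDomain MeasureTheory
open scoped Matrix MatrixGroups

namespace Summit.HodgeConjecture.HodgeConjecture.Cruxes.H413.F0P3XiUnramSplitInstance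

open Literature.NumberTheory Literature.NumberTheory.Automorphic Literature.NumberTheory.Automorphic.UnitaryGroup
open Literature.NumberTheory.Rogawski1990 Literature.NumberTheory.GaloisRepresentations

/-! ## §1 `GL₃` side: `i_G(ξ_w)` is admissible -/

section GLSide

variable (F : Type) [Field F] [ValuativeRel F] [TopologicalSpace F] [IsNonarchimedeanLocalField F]

/-- **`i_G(ξ_w) = i_{P_{(2,1)}}((ν₀ ∘ det) ⊠ χ′)` IS ADMISSIBLE** (any labels): the inducing representation is one-dimensional and
`GL₃(F) = P · GL₃(𝒪)` with `GL₃(𝒪)` compact. [cite: BernsteinZelevinsky1976, §2.25] [cite: CartierCorvallis1979, §III.3] [cite: Rogawski1990, §13.1 p. 199] -/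
theorem isAdmissible_splitMemberGL [LocallyCompactSpace (standardParabolicGL F (Zelevinsky1980.lastBlockLabel 3))] (ν₀ χ' : Fˣ →* ℂˣ)
    (hν₀u : ∀ x, ‖((ν₀ x : ℂˣ) : ℂ)‖ = 1) (hν₀c : Continuous fun x => ((ν₀ x : ℂˣ) : ℂ)) (hχ'u : ∀ x, ‖((χ' x : ℂˣ) : ℂ)‖ = 1)
    (hχ'c : Continuous fun x => ((χ' x : ℂˣ) : ℂ)) :
    (splitMemberGL F ν₀ χ' hν₀u hν₀c hχ'u hχ'c).ρ.IsAdmissible :=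
  Representation.isAdmissible_smoothIndRep_of_isCompact _ _ (isCompact_glInt 3 F) fun g =>
    exists_parabolic_mul_glInt (monotone_lastBlockLabel 3) g

end GLSide

/-! ## §2 The split packet member `⟦i_G(ξ_w) ∘ cmSplitEquiv⟧` on `G′_v = U(H)(L⁺_v)` -/

section CMSide

variable (L : Type) [Field L] [NumberField L] [IsCMField L] (H : Matrix (Fin 3) (Fin 3) L)
  (hH : (H.map (cmConjRingHom L))ᵀ = H) (hHd : IsUnit H.det)
  (v : HeightOneSpectrum (𝓞 ↥(maximalRealSubfield L)))

/-- **The split packet member is ADMISSIBLE** (no hypothesis on the labels): admissibility of `i_G(ξ_w)` (§1) transported along the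
topological isomorphism `cmSplitEquiv : G′_v ≃ₜ* GL₃(L_w)` (★ `IrrClass.isAdmissible_comap_iff`). [cite: BushnellHenniart2006, §1.1–1.2]
[cite: Rogawski1990, §13.1 p. 199] -/
theorem isAdmissible_cmSplitPacket_πn (w : PlacesOver L v) (hw : IsCMField.complexConj L • w.1 ≠ w.1)
    (ν₀ χ' : (w.1.adicCompletion L)ˣ →* ℂˣ) (hν₀u : ∀ x, ‖((ν₀ x : ℂˣ) : ℂ)‖ = 1)
    (hν₀c : Continuous fun x => ((ν₀ x : ℂˣ) : ℂ)) (hχ'u : ∀ x, ‖((χ' x : ℂˣ) : ℂ)‖ = 1)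
    (hχ'c : Continuous fun x => ((χ' x : ℂˣ) : ℂ)) :
    (cmSplitPacket L H hH hHd v w hw ν₀ χ' hν₀u hν₀c hχ'u hχ'c).πn.IsAdmissible := by
  rw [cmSplitPacket_πn, ← IrrClass.comap_mk, IrrClass.isAdmissible_comap_iff, IrrClass.isAdmissible_mk]
  exact isAdmissible_splitMemberGL (w.1.adicCompletion L) ν₀ χ' hν₀u hν₀c hχ'u hχ'c

/-- **LEVEL MATCHING at a split place where `H_w ∈ GL₃(𝒪_w)`**: `cmSplitEquiv g ∈ GL₃(𝒪_w) ↔ g ∈ K_v = U(H)(𝒪_v)` (★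
`mem_localIntegralLevel_iff_of_ne`; `cmSplitEquiv` IS ★ `localSplitEquiv`). [cite: PlatonovRapinchuk1994, §5.1] [cite: Rogawski1990, §14.2 p. 233] -/
theorem cmSplitEquiv_mem_glInt_iff (w : PlacesOver L v) (hw : IsCMField.complexConj L • w.1 ≠ w.1)
    (hHw : (isUnit_placeForm_of_isUnit_det hHd w.1).unit ∈ glInt 3 (w.1.adicCompletion L))
    (g : (cmDatum L 3 H).Local v) :
    cmSplitEquiv L H hH hHd v w hw g ∈ glInt 3 (w.1.adicCompletion L) ↔ g ∈ cmLocalIntegralLevel L 3 H v :=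
  (mem_localIntegralLevel_iff_of_ne (IsCMField.complexConj L) 3 H (IsCMField.complexConj_ne_one L)
    ((map_cmConjRingHom_eq_map_complexConj L H) ▸ hH) w hw (isUnit_placeForm_of_isUnit_det hHd w.1) hHw g).symm

/-- **The split packet member is `K_v`-SPHERICAL for UNRAMIFIED labels** (`ν₀, χ′` trivial on the units of valuation `1`) at a place where
`H_w ∈ GL₃(𝒪_w)`: `dim i_G(ξ_w)^{GL₃(𝒪_w)} = 1` (★ `isSpherical_splitMemberGL`) transported through the level matching.
[cite: Rogawski1990, §12.2 pp. 173–174; §4.5 p. 45; §13.1 p. 199] [cite: CartierCorvallis1979, §IV.1] -/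
theorem isSpherical_cmSplitPacket_πn (w : PlacesOver L v) (hw : IsCMField.complexConj L • w.1 ≠ w.1)
    (ν₀ χ' : (w.1.adicCompletion L)ˣ →* ℂˣ) (hν₀u : ∀ x, ‖((ν₀ x : ℂˣ) : ℂ)‖ = 1)
    (hν₀c : Continuous fun x => ((ν₀ x : ℂˣ) : ℂ)) (hχ'u : ∀ x, ‖((χ' x : ℂˣ) : ℂ)‖ = 1)
    (hχ'c : Continuous fun x => ((χ' x : ℂˣ) : ℂ))
    (hν₀ : ∀ u : (w.1.adicCompletion L)ˣ, ValuativeRel.valuation (w.1.adicCompletion L) (u : w.1.adicCompletion L) = 1 → ν₀ u = 1)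
    (hχ' : ∀ u : (w.1.adicCompletion L)ˣ, ValuativeRel.valuation (w.1.adicCompletion L) (u : w.1.adicCompletion L) = 1 → χ' u = 1)
    (hHw : (isUnit_placeForm_of_isUnit_det hHd w.1).unit ∈ glInt 3 (w.1.adicCompletion L)) :
    (cmSplitPacket L H hH hHd v w hw ν₀ χ' hν₀u hν₀c hχ'u hχ'c).πn.IsSpherical (cmLocalIntegralLevel L 3 H v) := by
  rw [cmSplitPacket_πn, ← IrrClass.comap_mk,
    IrrClass.isSpherical_comap_iff_of_forall_mem_iff _ _ (cmSplitEquiv_mem_glInt_iff L H hH hHd v w hw hHw), IrrClass.isSpherical_mk]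
  exact isSpherical_splitMemberGL (w.1.adicCompletion L) ν₀ χ' hν₀u hν₀c hχ'u hχ'c hν₀ hχ'

/-- `μ(K_v) ≠ 0` (as a real number) for a Haar measure: `K_v = U(H)(𝒪_v)` is compact open (★ `isCompact_isOpen_cmLocalIntegralLevel`).
[cite: PlatonovRapinchuk1994, §5.1] -/
theorem measureReal_cmLocalIntegralLevel_ne_zero [MeasurableSpace ((cmDatum L 3 H).Local v)] [BorelSpace ((cmDatum L 3 H).Local v)]
    (μ : Measure ((cmDatum L 3 H).Local v)) [μ.IsHaarMeasure] :
    μ.real (cmLocalIntegralLevel L 3 H v : Set ((cmDatum L 3 H).Local v)) ≠ 0 := by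
  have hK := isCompact_isOpen_cmLocalIntegralLevel L 3 H v
  rw [measureReal_def, ENNReal.toReal_ne_zero]
  exact ⟨(hK.2.measure_pos μ ⟨1, (cmLocalIntegralLevel L 3 H v).one_mem⟩).ne', hK.1.measure_lt_top.ne⟩

/-- **The split packet member is `K_v`-SPHERICAL WITH AN EIGENCHARACTER in the pin-(ii) currency** ★ `IrrClass.IsSphericalWith K_v μ t`, with
`t` THE normalised class character `f ↦ μ(K_v)⁻¹ · tr πⁿ(f)` (★ `IsSpherical.isSphericalWith_smoothTrace`), for every Haar measure `μ` on `G′_v`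
(unramified labels, `H_w ∈ GL₃(𝒪_w)`). [cite: Rogawski1990, §13.7 p. 206; §12.2 pp. 173–174] [cite: CartierCorvallis1979, §IV.1 Cor. 4.1] -/
theorem isSphericalWith_cmSplitPacket_πn [MeasurableSpace ((cmDatum L 3 H).Local v)] [BorelSpace ((cmDatum L 3 H).Local v)]
    (μ : Measure ((cmDatum L 3 H).Local v)) [μ.IsHaarMeasure]
    (w : PlacesOver L v) (hw : IsCMField.complexConj L • w.1 ≠ w.1)
    (ν₀ χ' : (w.1.adicCompletion L)ˣ →* ℂˣ) (hν₀u : ∀ x, ‖((ν₀ x : ℂˣ) : ℂ)‖ = 1)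
    (hν₀c : Continuous fun x => ((ν₀ x : ℂˣ) : ℂ)) (hχ'u : ∀ x, ‖((χ' x : ℂˣ) : ℂ)‖ = 1)
    (hχ'c : Continuous fun x => ((χ' x : ℂˣ) : ℂ))
    (hν₀ : ∀ u : (w.1.adicCompletion L)ˣ, ValuativeRel.valuation (w.1.adicCompletion L) (u : w.1.adicCompletion L) = 1 → ν₀ u = 1)
    (hχ' : ∀ u : (w.1.adicCompletion L)ˣ, ValuativeRel.valuation (w.1.adicCompletion L) (u : w.1.adicCompletion L) = 1 → χ' u = 1)
    (hHw : (isUnit_placeForm_of_isUnit_det hHd w.1).unit ∈ glInt 3 (w.1.adicCompletion L)) :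
    (cmSplitPacket L H hH hHd v w hw ν₀ χ' hν₀u hν₀c hχ'u hχ'c).πn.IsSphericalWith (cmLocalIntegralLevel L 3 H v) μ fun f =>
      (μ.real (cmLocalIntegralLevel L 3 H v : Set ((cmDatum L 3 H).Local v)) : ℂ)⁻¹ *
        (cmSplitPacket L H hH hHd v w hw ν₀ χ' hν₀u hν₀c hχ'u hχ'c).πn.smoothTrace μ f :=
  IrrClass.IsSpherical.isSphericalWith_smoothTrace μ (isAdmissible_cmSplitPacket_πn L H hH hHd v w hw ν₀ χ' hν₀u hν₀c hχ'u hχ'c)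
    (isCompact_isOpen_cmLocalIntegralLevel L 3 H v).2 (isCompact_isOpen_cmLocalIntegralLevel L 3 H v).1
    (measureReal_cmLocalIntegralLevel_ne_zero L H v μ)
    (isSpherical_cmSplitPacket_πn L H hH hHd v w hw ν₀ χ' hν₀u hν₀c hχ'u hχ'c hν₀ hχ' hHw)

/-- **`XiUnram` AT A SPLIT PLACE, parameter form** (the shape of T5's anchor law, RULING (V11)(ii): `IsSphericalWith K_v μ t ∧ IsAdmissible` for
the unramified member). [cite: Rogawski1990, §12.2 pp. 173–174; §13.1 p. 199; §13.7 p. 206] [cite: CartierCorvallis1979, §IV.1 Cor. 4.1] -/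
theorem xiUnram_cmSplitPacket [MeasurableSpace ((cmDatum L 3 H).Local v)] [BorelSpace ((cmDatum L 3 H).Local v)]
    (μ : Measure ((cmDatum L 3 H).Local v)) [μ.IsHaarMeasure]
    (w : PlacesOver L v) (hw : IsCMField.complexConj L • w.1 ≠ w.1)
    (ν₀ χ' : (w.1.adicCompletion L)ˣ →* ℂˣ) (hν₀u : ∀ x, ‖((ν₀ x : ℂˣ) : ℂ)‖ = 1)
    (hν₀c : Continuous fun x => ((ν₀ x : ℂˣ) : ℂ)) (hχ'u : ∀ x, ‖((χ' x : ℂˣ) : ℂ)‖ = 1)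
    (hχ'c : Continuous fun x => ((χ' x : ℂˣ) : ℂ))
    (hν₀ : ∀ u : (w.1.adicCompletion L)ˣ, ValuativeRel.valuation (w.1.adicCompletion L) (u : w.1.adicCompletion L) = 1 → ν₀ u = 1)
    (hχ' : ∀ u : (w.1.adicCompletion L)ˣ, ValuativeRel.valuation (w.1.adicCompletion L) (u : w.1.adicCompletion L) = 1 → χ' u = 1)
    (hHw : (isUnit_placeForm_of_isUnit_det hHd w.1).unit ∈ glInt 3 (w.1.adicCompletion L)) :
    (cmSplitPacket L H hH hHd v w hw ν₀ χ' hν₀u hν₀c hχ'u hχ'c).πn.IsSphericalWith (cmLocalIntegralLevel L 3 H v) μ (fun f =>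
      (μ.real (cmLocalIntegralLevel L 3 H v : Set ((cmDatum L 3 H).Local v)) : ℂ)⁻¹ *
        (cmSplitPacket L H hH hHd v w hw ν₀ χ' hν₀u hν₀c hχ'u hχ'c).πn.smoothTrace μ f) ∧
      (cmSplitPacket L H hH hHd v w hw ν₀ χ' hν₀u hν₀c hχ'u hχ'c).πn.IsAdmissible :=
  ⟨isSphericalWith_cmSplitPacket_πn L H hH hHd v μ w hw ν₀ χ' hν₀u hν₀c hχ'u hχ'c hν₀ hχ' hHw,
    isAdmissible_cmSplitPacket_πn L H hH hHd v w hw ν₀ χ' hν₀u hν₀c hχ'u hχ'c⟩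

end CMSide

/-! ## §3 The split clause of a ξ-LOCAL FAMILY (★ D6 `OneDimAutRepH.IsXiLocalFamily`) -/

section XiSide

variable {L : Type} [Field L] [NumberField L] [IsCMField L] {H : Matrix (Fin 3) (Fin 3) L}
  {hH : (H.map (cmConjRingHom L))ᵀ = H} {hHd : IsUnit H.det} {μω : HeckeCharacter L} {hμu : μω.IsUnitary}
  {Pv : ∀ v : HeightOneSpectrum (𝓞 ↥(maximalRealSubfield L)), CMLocalAPacket L H v}

/-- **The labels `ν₀ = η_w ψ_w μ_w` are UNRAMIFIED when `η̃, ψ̃, μ` are unramified at `w`** (valuation currency of ★ `isSpherical_splitMemberGL`).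
[cite: Rogawski1990, §4.13 Lemma 4.13.1 (b); §12.2 p. 174] [cite: TateThesis1967, §2.3] -/
theorem splitν₀_eq_one_of_isUnramifiedAt (ξ : OneDimAutRepH L) (μω : HeckeCharacter L) {w : HeightOneSpectrum (𝓞 L)}
    (hη : ξ.bcη.IsUnramifiedAt w) (hψ : ξ.bcψ.IsUnramifiedAt w) (hμ : μω.IsUnramifiedAt w)
    (u : (w.adicCompletion L)ˣ) (hu : ValuativeRel.valuation (w.adicCompletion L) (u : w.adicCompletion L) = 1) :
    ξ.splitν₀ μω w u = 1 := by
  rw [OneDimAutRepH.splitν₀_apply, OneDimAutRepH.locη_apply, OneDimAutRepH.locψ_apply,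
    hη.localComponent_eq_one_of_valuation_eq_one hu, hψ.localComponent_eq_one_of_valuation_eq_one hu,
    hμ.localComponent_eq_one_of_valuation_eq_one hu, inv_one, one_mul, one_mul]

/-- **The label `χ′ = ψ_w` is UNRAMIFIED when `ψ̃` is unramified at `w`.** [cite: Rogawski1990, §4.13 Lemma 4.13.1 (b); §12.2 p. 174] [cite: TateThesis1967, §2.3] -/
theorem locψ_eq_one_of_isUnramifiedAt (ξ : OneDimAutRepH L) {w : HeightOneSpectrum (𝓞 L)} (hψ : ξ.bcψ.IsUnramifiedAt w)
    (u : (w.adicCompletion L)ˣ) (hu : ValuativeRel.valuation (w.adicCompletion L) (u : w.adicCompletion L) = 1) :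
    ξ.locψ w u = 1 := by
  rw [OneDimAutRepH.locψ_apply, hψ.localComponent_eq_one_of_valuation_eq_one hu, inv_one]

/-- **A ξ-local family's member at a split place is ADMISSIBLE** (no ramification hypothesis): its split clause IS `cmSplitPacket` at the fixed
witness (★ `IsXiLocalFamily.eq_cmSplitPacket`). [cite: Rogawski1990, §13.1 p. 199; §4.13 Lemma 4.13.1 (b)] [cite: BernsteinZelevinsky1976, §2.25] -/
theorem isAdmissible_πn_of_isXiLocalFamily_of_split {ξ : OneDimAutRepH L} (h : ξ.IsXiLocalFamily hH hHd μω hμu Pv)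
    (v : HeightOneSpectrum (𝓞 ↥(maximalRealSubfield L))) (hs : ∃ w : PlacesOver L v, IsCMField.complexConj L • w.1 ≠ w.1) :
    (Pv v).πn.IsAdmissible := by
  rw [h.eq_cmSplitPacket v hs]
  exact isAdmissible_cmSplitPacket_πn L H hH hHd v _ _ _ _ _ _ _ _

/-- **A ξ-local family's member at a split place `v ∉ ram ξ` is `K_v`-SPHERICAL**, where «`v ∉ ram ξ`» (split `v`) reads: `η̃, ψ̃, μ` unramified at
the fixed witness `w = splitWitness v hs` and `H_w ∈ GL₃(𝒪_w)`. [cite: Rogawski1990, §12.2 pp. 173–174 («`πⁿ(ξ_v)` is unramified if `ξ_v` is»); §13.1 p. 199]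
[cite: CartierCorvallis1979, §IV.1] -/
theorem isSpherical_πn_of_isXiLocalFamily_of_split {ξ : OneDimAutRepH L} (h : ξ.IsXiLocalFamily hH hHd μω hμu Pv)
    (v : HeightOneSpectrum (𝓞 ↥(maximalRealSubfield L))) (hs : ∃ w : PlacesOver L v, IsCMField.complexConj L • w.1 ≠ w.1)
    (hη : ξ.bcη.IsUnramifiedAt (splitWitness v hs).1) (hψ : ξ.bcψ.IsUnramifiedAt (splitWitness v hs).1)
    (hμ : μω.IsUnramifiedAt (splitWitness v hs).1)
    (hHw : (isUnit_placeForm_of_isUnit_det hHd (splitWitness v hs).1).unit ∈ glInt 3 ((splitWitness v hs).1.adicCompletion L)) :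
    (Pv v).πn.IsSpherical (cmLocalIntegralLevel L 3 H v) := by
  rw [h.eq_cmSplitPacket v hs]
  exact isSpherical_cmSplitPacket_πn L H hH hHd v _ _ _ _ _ _ _ _ (splitν₀_eq_one_of_isUnramifiedAt ξ μω hη hψ hμ)
    (locψ_eq_one_of_isUnramifiedAt ξ hψ) hHw

/-- **A ξ-local family's member at a split place `v ∉ ram ξ` is `K_v`-SPHERICAL WITH THE EIGENCHARACTER `t(ξ_v)`** := its normalised class
character (pin-(ii) currency ★ `IrrClass.IsSphericalWith`), for every Haar measure on `G′_v`.
[cite: Rogawski1990, §13.7 p. 206; §12.2 pp. 173–174; §13.1 p. 199] [cite: CartierCorvallis1979, §IV.1 Cor. 4.1] -/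
theorem isSphericalWith_πn_of_isXiLocalFamily_of_split {ξ : OneDimAutRepH L} (h : ξ.IsXiLocalFamily hH hHd μω hμu Pv)
    (v : HeightOneSpectrum (𝓞 ↥(maximalRealSubfield L))) [MeasurableSpace ((cmDatum L 3 H).Local v)] [BorelSpace ((cmDatum L 3 H).Local v)]
    (μ : Measure ((cmDatum L 3 H).Local v)) [μ.IsHaarMeasure]
    (hs : ∃ w : PlacesOver L v, IsCMField.complexConj L • w.1 ≠ w.1)
    (hη : ξ.bcη.IsUnramifiedAt (splitWitness v hs).1) (hψ : ξ.bcψ.IsUnramifiedAt (splitWitness v hs).1)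
    (hμ : μω.IsUnramifiedAt (splitWitness v hs).1)
    (hHw : (isUnit_placeForm_of_isUnit_det hHd (splitWitness v hs).1).unit ∈ glInt 3 ((splitWitness v hs).1.adicCompletion L)) :
    (Pv v).πn.IsSphericalWith (cmLocalIntegralLevel L 3 H v) μ fun f =>
      (μ.real (cmLocalIntegralLevel L 3 H v : Set ((cmDatum L 3 H).Local v)) : ℂ)⁻¹ * (Pv v).πn.smoothTrace μ f :=
  IrrClass.IsSpherical.isSphericalWith_smoothTrace μ (isAdmissible_πn_of_isXiLocalFamily_of_split h v hs)
    (isCompact_isOpen_cmLocalIntegralLevel L 3 H v).2 (isCompact_isOpen_cmLocalIntegralLevel L 3 H v).1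
    (measureReal_cmLocalIntegralLevel_ne_zero L H v μ) (isSpherical_πn_of_isXiLocalFamily_of_split h v hs hη hψ hμ hHw)

/-- **`XiUnram` AT A SPLIT PLACE for a ξ-local family** (the conjunction RULING (V11)(ii) asks of `(packFin ξ v).πn` at 𝔠₀, split `v ∉ ram ξ`).
[cite: Rogawski1990, §12.2 pp. 173–174; §13.1 p. 199; §13.7 p. 206] [cite: CartierCorvallis1979, §IV.1 Cor. 4.1] -/
theorem xiUnram_of_isXiLocalFamily_of_split {ξ : OneDimAutRepH L} (h : ξ.IsXiLocalFamily hH hHd μω hμu Pv)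
    (v : HeightOneSpectrum (𝓞 ↥(maximalRealSubfield L))) [MeasurableSpace ((cmDatum L 3 H).Local v)] [BorelSpace ((cmDatum L 3 H).Local v)]
    (μ : Measure ((cmDatum L 3 H).Local v)) [μ.IsHaarMeasure]
    (hs : ∃ w : PlacesOver L v, IsCMField.complexConj L • w.1 ≠ w.1)
    (hη : ξ.bcη.IsUnramifiedAt (splitWitness v hs).1) (hψ : ξ.bcψ.IsUnramifiedAt (splitWitness v hs).1)
    (hμ : μω.IsUnramifiedAt (splitWitness v hs).1)
    (hHw : (isUnit_placeForm_of_isUnit_det hHd (splitWitness v hs).1).unit ∈ glInt 3 ((splitWitness v hs).1.adicCompletion L)) :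
    (Pv v).πn.IsSphericalWith (cmLocalIntegralLevel L 3 H v) μ (fun f =>
      (μ.real (cmLocalIntegralLevel L 3 H v : Set ((cmDatum L 3 H).Local v)) : ℂ)⁻¹ * (Pv v).πn.smoothTrace μ f) ∧
      (Pv v).πn.IsAdmissible :=
  ⟨isSphericalWith_πn_of_isXiLocalFamily_of_split h v μ hs hη hψ hμ hHw, isAdmissible_πn_of_isXiLocalFamily_of_split h v hs⟩

end XiSide

/-! ## §4 The split «`v ∉ ram ξ`» hypotheses hold at ALMOST EVERY place (so `ram ξ` at 𝔠₀ is finite on the split side) -/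

section Cofinite

variable {L : Type} [Field L] [NumberField L] [IsCMField L] {H : Matrix (Fin 3) (Fin 3) L}

/-- **The unramified hypotheses of §3 hold for all but finitely many `v`** (at EVERY `w ∣ v`): `η̃, ψ̃, μ` are unramified almost everywhere
(★ `HeckeCharacter.isUnramifiedAt_cofinite_holds`, Tate's Lemma 3.2.1, regrouped over the places of `L⁺` by ★ `eventually_forall_placesOver`) and
`H_w ∈ GL₃(𝒪_w)` almost everywhere (★ `eventually_forall_unit_placeForm_mem_glInt`). [cite: TateThesis1967, Lemma 3.2.1] [cite: PlatonovRapinchuk1994, §5.1]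
[cite: Rogawski1990, §12.2 p. 174] -/
theorem eventually_forall_placesOver_splitUnram (ξ : OneDimAutRepH L) (μω : HeckeCharacter L) (hHd : IsUnit H.det) :
    ∀ᶠ v : HeightOneSpectrum (𝓞 ↥(maximalRealSubfield L)) in Filter.cofinite, ∀ w : PlacesOver L v,
      ξ.bcη.IsUnramifiedAt w.1 ∧ ξ.bcψ.IsUnramifiedAt w.1 ∧ μω.IsUnramifiedAt w.1 ∧
        (isUnit_placeForm_of_isUnit_det hHd w.1).unit ∈ glInt 3 (w.1.adicCompletion L) := by
  filter_upwards [eventually_forall_placesOver (F := ↥(maximalRealSubfield L)) L (HeckeCharacter.isUnramifiedAt_cofinite_holds ξ.bcη),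
    eventually_forall_placesOver (F := ↥(maximalRealSubfield L)) L (HeckeCharacter.isUnramifiedAt_cofinite_holds ξ.bcψ),
    eventually_forall_placesOver (F := ↥(maximalRealSubfield L)) L (HeckeCharacter.isUnramifiedAt_cofinite_holds μω),
    eventually_forall_unit_placeForm_mem_glInt (F := ↥(maximalRealSubfield L)) 3 H ((Matrix.isUnit_iff_isUnit_det H).2 hHd)]
    with v h₁ h₂ h₃ h₄ w
  exact ⟨h₁ w, h₂ w, h₃ w, h₄ w⟩

/-- **`XiUnram` holds at ALMOST EVERY split place for a ξ-local family** (for any family of Haar measures): the finitely many exceptions are the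
split part of `ram ξ` at 𝔠₀. [cite: Rogawski1990, §12.2 pp. 173–174; §13.1 p. 199; §13.7 p. 206] [cite: TateThesis1967, Lemma 3.2.1] -/
theorem eventually_xiUnram_of_isXiLocalFamily_of_split {hH : (H.map (cmConjRingHom L))ᵀ = H} {hHd : IsUnit H.det}
    {μω : HeckeCharacter L} {hμu : μω.IsUnitary} {Pv : ∀ v : HeightOneSpectrum (𝓞 ↥(maximalRealSubfield L)), CMLocalAPacket L H v}
    {ξ : OneDimAutRepH L} (h : ξ.IsXiLocalFamily hH hHd μω hμu Pv)
    [∀ v : HeightOneSpectrum (𝓞 ↥(maximalRealSubfield L)), MeasurableSpace ((cmDatum L 3 H).Local v)]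
    [∀ v : HeightOneSpectrum (𝓞 ↥(maximalRealSubfield L)), BorelSpace ((cmDatum L 3 H).Local v)]
    (μv : ∀ v : HeightOneSpectrum (𝓞 ↥(maximalRealSubfield L)), Measure ((cmDatum L 3 H).Local v)) [∀ v, (μv v).IsHaarMeasure] :
    ∀ᶠ v : HeightOneSpectrum (𝓞 ↥(maximalRealSubfield L)) in Filter.cofinite,
      ∀ hs : ∃ w : PlacesOver L v, IsCMField.complexConj L • w.1 ≠ w.1,
        (Pv v).πn.IsSphericalWith (cmLocalIntegralLevel L 3 H v) (μv v) (fun f =>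
          ((μv v).real (cmLocalIntegralLevel L 3 H v : Set ((cmDatum L 3 H).Local v)) : ℂ)⁻¹ * (Pv v).πn.smoothTrace (μv v) f) ∧
        (Pv v).πn.IsAdmissible := by
  filter_upwards [eventually_forall_placesOver_splitUnram ξ μω hHd] with v hv hs
  obtain ⟨hη, hψ, hμ, hHw⟩ := hv (splitWitness v hs)
  exact xiUnram_of_isXiLocalFamily_of_split h v (μv v) hs hη hψ hμ hHw

end Cofinite

end Summit.HodgeConjecture.HodgeConjecture.Cruxes.H413.F0P3XiUnramSplitInstance

end
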